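import Literature.NumberTheory.Rogawski1990.AdelicInnerTransferAssembly
import Literature.NumberTheory.Rogawski1990.LocalInnerTransferTransportBasePoint
import HarnessLib

/-!
# The adelic `κ = 1` inner-transfer ASSEMBLY WITHOUT REGULARITY: ★ G1 with the placewise identities as EQUATION binders, and for the
# ψ-transported local data (Rogawski (1990), §14.2 (14.2.1) p. 232, §14.5 p. 238; Gelbart (1975), §10 pp. 154–155)

Topic `NumberTheory/Rogawski1990`; namespace `Literature.NumberTheory.Rogawski1990`; THEOREMS ONLY (no definition, no instance, no named fact, no
`sorry`).  Row K6-ζ (ζ3) + (ζ2∘ζ3) of the O7 «singular semisimple classes» programme (O7 OWNER WORD #10 (2)): regularity enters ★ G1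
`adelicStableOrbitalSum_classesSelf_eq_adelicStableOrbitalIntegralG_of_innerTransfer` ONLY through the relations ★ `IsLocalInnerTransfer` ∕ ★
`IsArchInnerTransfer`, which STATE (14.2.1) at regular elements.  Here the placewise identities are taken as EQUATIONS at the pair `γ₀ ↔ γ` itself, so the
assembly (★ glue `adelicStableOrbitalSum_eq_of_isEulerOnClasses_of_forall_mul_prod_eq`) holds at ANY pair; for the kit's own quasi-split data — the
ψ-TRANSPORT of the inner form's (`m_v = (ψ_v)_* m′_v`, `f_v = f′_v ∘ ψ_v⁻¹`, (D1) ∕ pin (ix)) — the finite-place equations are ★ (ζ2)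
`localStableOrbitalIntegral_base_eq_of_loc_eq_comp_symm` (`LocalInnerTransferTransportBasePoint`, every element), so that at a singular `γ₀` exactly ONE
archimedean equation remains a binder (printed: `G′_∞ ≇ G_∞`), next to the two Euler forms.

* **`adelicStableOrbitalSum_classesSelf_eq_adelicStableOrbitalIntegralG_of_forall_eq`** (ζ3: ★ G1 :101 with the binders `hloc`, `harch`, `hreg` replaced
  by two equations — any pair `γ₀ ↔ γ`, any local ∕ archimedean data);
* **`adelicStableOrbitalSum_classesSelf_eq_adelicStableOrbitalIntegralG_of_transport`** (ζ2∘ζ3: transported local data, pure tensors with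
  `T′_v = T_v ∘ ψ_v⁻¹`; remaining binders = one archimedean equation + the two Euler forms).

## References
* J. D. Rogawski, *Automorphic Representations of Unitary Groups in Three Variables*, Ann. of Math. Stud. 123 (1990), §14.2 (14.2.1) p. 232, §14.5 p. 238
  [Rogawski1990].
* S. Gelbart, *Automorphic forms on adele groups*, Ann. of Math. Stud. 83 (1975), §10 pp. 154–155 [Gelbart1975].
-/

set_option autoImplicit false

noncomputable section

open MeasureTheory NumberField IsDedekindDomain Topology
open scoped Matrix MatrixGroups

namespace Literature.NumberTheory.Rogawski1990

open Literature.NumberTheory.Automorphic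

/-! ## (ζ3) The adelic assembly with equation binders, and (ζ2∘ζ3) for the transported data -/

section Assembly

variable {L : Type} [Field L] [NumberField L] [IsCMField L] {H : Matrix (Fin 3) (Fin 3) L}
  {γ₀ : (UnitaryGroup.cmDatum L 3 H).Rational} {γ : (UnitaryGroup.cmDatum L 3 (Matrix.of fun i j : Fin 3 => if i.val + j.val + 1 = 3 then (1 : L) else 0)).Rational}

variable
  [∀ (v : HeightOneSpectrum (𝓞 ↥(maximalRealSubfield L))) (x : (UnitaryGroup.cmDatum L 3 H).Local v),
    MeasurableSpace ((UnitaryGroup.cmDatum L 3 H).Local v ⧸ Subgroup.centralizer ({x} : Set ((UnitaryGroup.cmDatum L 3 H).Local v)))]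
  [∀ (v : HeightOneSpectrum (𝓞 ↥(maximalRealSubfield L))) (x : (UnitaryGroup.cmDatum L 3 (Matrix.of fun i j : Fin 3 => if i.val + j.val + 1 = 3 then (1 : L) else 0)).Local v),
    MeasurableSpace ((UnitaryGroup.cmDatum L 3 (Matrix.of fun i j : Fin 3 => if i.val + j.val + 1 = 3 then (1 : L) else 0)).Local v ⧸
      Subgroup.centralizer ({x} : Set ((UnitaryGroup.cmDatum L 3 (Matrix.of fun i j : Fin 3 => if i.val + j.val + 1 = 3 then (1 : L) else 0)).Local v)))]
  [∀ a : UnitaryGroup.arch (↥(maximalRealSubfield L)) L (IsCMField.complexConj L) 3 H,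
    MeasurableSpace (UnitaryGroup.arch (↥(maximalRealSubfield L)) L (IsCMField.complexConj L) 3 H ⧸
      Subgroup.centralizer ({a} : Set (UnitaryGroup.arch (↥(maximalRealSubfield L)) L (IsCMField.complexConj L) 3 H)))]
  [∀ a : UnitaryGroup.arch (↥(maximalRealSubfield L)) L (IsCMField.complexConj L) 3 (Matrix.of fun i j : Fin 3 => if i.val + j.val + 1 = 3 then (1 : L) else 0),
    MeasurableSpace (UnitaryGroup.arch (↥(maximalRealSubfield L)) L (IsCMField.complexConj L) 3 (Matrix.of fun i j : Fin 3 => if i.val + j.val + 1 = 3 then (1 : L) else 0) ⧸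
      Subgroup.centralizer ({a} : Set (UnitaryGroup.arch (↥(maximalRealSubfield L)) L (IsCMField.complexConj L) 3 (Matrix.of fun i j : Fin 3 => if i.val + j.val + 1 = 3 then (1 : L) else 0))))]
  [∀ g : (UnitaryGroup.cmDatum L 3 H).Adelic,
    MeasurableSpace ((UnitaryGroup.cmDatum L 3 H).Adelic ⧸ Subgroup.centralizer ({g} : Set (UnitaryGroup.cmDatum L 3 H).Adelic))]
  [∀ g : (UnitaryGroup.cmDatum L 3 (Matrix.of fun i j : Fin 3 => if i.val + j.val + 1 = 3 then (1 : L) else 0)).Adelic,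
    MeasurableSpace ((UnitaryGroup.cmDatum L 3 (Matrix.of fun i j : Fin 3 => if i.val + j.val + 1 = 3 then (1 : L) else 0)).Adelic ⧸ Subgroup.centralizer ({g} : Set (UnitaryGroup.cmDatum L 3 (Matrix.of fun i j : Fin 3 => if i.val + j.val + 1 = 3 then (1 : L) else 0)).Adelic))]

/-- **(ζ3) THE ADELIC `κ = 1` IDENTITY FROM PLACEWISE EQUATIONS** — ★ G1 with the relations `IsLocalInnerTransfer` ∕ `IsArchInnerTransfer` and `hreg`
replaced by the two EQUATIONS they deliver at a regular pair, now taken as binders at ANY pair: if `Φ′^st_v((γ₀)_v, f′_v; m′_v) = Φ^st_v(γ_v, f_v; m_v)`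
at every finite `v` and `Φ′^st_∞(γ₀ ⊗ 1, a′; mi′) = Φ^st_∞(γ ⊗ 1, a; mi)`, and the two adelic stable sums have the Euler forms with those factors
eventually in `S`, then `Φ^{st,𝐀}_{G′}(γ₀; mA′, F′) = Φ^{st,𝐀}_G(γ₀; mA, F)` (★ glue `adelicStableOrbitalSum_eq_of_isEulerOnClasses_of_forall_mul_prod_eq`).
[cite: Rogawski1990, §14.2 (14.2.1) p. 232; §14.5 p. 238] -/
theorem adelicStableOrbitalSum_classesSelf_eq_adelicStableOrbitalIntegralG_of_forall_eq
    (m' : ∀ v : HeightOneSpectrum (𝓞 ↥(maximalRealSubfield L)), OrbitalMeasureFamily ((UnitaryGroup.cmDatum L 3 H).Local v))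
    (m : ∀ v : HeightOneSpectrum (𝓞 ↥(maximalRealSubfield L)), OrbitalMeasureFamily ((UnitaryGroup.cmDatum L 3 (Matrix.of fun i j : Fin 3 => if i.val + j.val + 1 = 3 then (1 : L) else 0)).Local v))
    (mi' : OrbitalMeasureFamily (UnitaryGroup.arch (↥(maximalRealSubfield L)) L (IsCMField.complexConj L) 3 H))
    (mi : OrbitalMeasureFamily (UnitaryGroup.arch (↥(maximalRealSubfield L)) L (IsCMField.complexConj L) 3 (Matrix.of fun i j : Fin 3 => if i.val + j.val + 1 = 3 then (1 : L) else 0)))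
    (f' : ∀ v : HeightOneSpectrum (𝓞 ↥(maximalRealSubfield L)), (UnitaryGroup.cmDatum L 3 H).Local v → ℂ)
    (f : ∀ v : HeightOneSpectrum (𝓞 ↥(maximalRealSubfield L)), (UnitaryGroup.cmDatum L 3 (Matrix.of fun i j : Fin 3 => if i.val + j.val + 1 = 3 then (1 : L) else 0)).Local v → ℂ)
    (a' : UnitaryGroup.arch (↥(maximalRealSubfield L)) L (IsCMField.complexConj L) 3 H → ℂ)
    (a : UnitaryGroup.arch (↥(maximalRealSubfield L)) L (IsCMField.complexConj L) 3 (Matrix.of fun i j : Fin 3 => if i.val + j.val + 1 = 3 then (1 : L) else 0) → ℂ)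
    (hloc : ∀ v, localStableOrbitalIntegral L 3 H v (m' v) (f' v) ((UnitaryGroup.cmDatum L 3 H).toLocal v ((UnitaryGroup.cmDatum L 3 H).toAdelic γ₀)) =
      localStableOrbitalIntegral L 3 (Matrix.of fun i j : Fin 3 => if i.val + j.val + 1 = 3 then (1 : L) else 0) v (m v) (f v) ((UnitaryGroup.cmDatum L 3 (Matrix.of fun i j : Fin 3 => if i.val + j.val + 1 = 3 then (1 : L) else 0)).toLocal v ((UnitaryGroup.cmDatum L 3 (Matrix.of fun i j : Fin 3 => if i.val + j.val + 1 = 3 then (1 : L) else 0)).toAdelic γ)))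
    (harch : archStableOrbitalIntegral L 3 H mi' a' (cmRationalToArch L 3 H γ₀) = archStableOrbitalIntegral L 3 (Matrix.of fun i j : Fin 3 => if i.val + j.val + 1 = 3 then (1 : L) else 0) mi a (cmRationalToArch L 3 (Matrix.of fun i j : Fin 3 => if i.val + j.val + 1 = 3 then (1 : L) else 0) γ))
    (mA' : OrbitalMeasureFamily (UnitaryGroup.cmDatum L 3 H).Adelic) (F' : (UnitaryGroup.cmDatum L 3 H).Adelic → ℂ)
    (mA : OrbitalMeasureFamily (UnitaryGroup.cmDatum L 3 (Matrix.of fun i j : Fin 3 => if i.val + j.val + 1 = 3 then (1 : L) else 0)).Adelic) (F : (UnitaryGroup.cmDatum L 3 (Matrix.of fun i j : Fin 3 => if i.val + j.val + 1 = 3 then (1 : L) else 0)).Adelic → ℂ)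
    (hG' : ∃ S₁' : Finset (HeightOneSpectrum (𝓞 ↥(maximalRealSubfield L))), ∀ S, S₁' ⊆ S →
      IsEulerOnClasses (MatchingAdeleG₂.classes L H H γ₀) mA' F' S
        (fun v => localStableOrbitalIntegral L 3 H v (m' v) (f' v) ((UnitaryGroup.cmDatum L 3 H).toLocal v ((UnitaryGroup.cmDatum L 3 H).toAdelic γ₀)))
        (archStableOrbitalIntegral L 3 H mi' a' (cmRationalToArch L 3 H γ₀)))
    (hG : ∃ S₁ : Finset (HeightOneSpectrum (𝓞 ↥(maximalRealSubfield L))), ∀ S, S₁ ⊆ S →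
      IsEulerOnClasses (MatchingAdeleG.classes L H γ₀) mA F S
        (fun v => localStableOrbitalIntegral L 3 (Matrix.of fun i j : Fin 3 => if i.val + j.val + 1 = 3 then (1 : L) else 0) v (m v) (f v) ((UnitaryGroup.cmDatum L 3 (Matrix.of fun i j : Fin 3 => if i.val + j.val + 1 = 3 then (1 : L) else 0)).toLocal v ((UnitaryGroup.cmDatum L 3 (Matrix.of fun i j : Fin 3 => if i.val + j.val + 1 = 3 then (1 : L) else 0)).toAdelic γ)))
        (archStableOrbitalIntegral L 3 (Matrix.of fun i j : Fin 3 => if i.val + j.val + 1 = 3 then (1 : L) else 0) mi a (cmRationalToArch L 3 (Matrix.of fun i j : Fin 3 => if i.val + j.val + 1 = 3 then (1 : L) else 0) γ))) :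
    adelicStableOrbitalSum (MatchingAdeleG₂.classes L H H γ₀) mA' F' = adelicStableOrbitalIntegralG L H γ₀ mA F := by
  classical
  rw [adelicStableOrbitalIntegralG]
  refine adelicStableOrbitalSum_eq_of_isEulerOnClasses_of_forall_mul_prod_eq hG' hG fun S => ?_
  rw [harch]
  exact congrArg _ (Finset.prod_congr rfl fun v _ => hloc v)

variable
  [∀ (v : HeightOneSpectrum (𝓞 ↥(maximalRealSubfield L))) (x : (UnitaryGroup.cmDatum L 3 H).Local v),
    BorelSpace ((UnitaryGroup.cmDatum L 3 H).Local v ⧸ Subgroup.centralizer ({x} : Set ((UnitaryGroup.cmDatum L 3 H).Local v)))]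
  [∀ (v : HeightOneSpectrum (𝓞 ↥(maximalRealSubfield L))) (x : (UnitaryGroup.cmDatum L 3 (Matrix.of fun i j : Fin 3 => if i.val + j.val + 1 = 3 then (1 : L) else 0)).Local v),
    BorelSpace ((UnitaryGroup.cmDatum L 3 (Matrix.of fun i j : Fin 3 => if i.val + j.val + 1 = 3 then (1 : L) else 0)).Local v ⧸
      Subgroup.centralizer ({x} : Set ((UnitaryGroup.cmDatum L 3 (Matrix.of fun i j : Fin 3 => if i.val + j.val + 1 = 3 then (1 : L) else 0)).Local v)))]

/-- **(ζ2∘ζ3) THE ADELIC `κ = 1` IDENTITY FOR THE TRANSPORTED LOCAL DATA, ANY PAIR `γ₀ ↔ γ`**: with `m_v := (ψ_v)_* m′_v` and `T′_v = T_v ∘ ψ_v⁻¹` at every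
finite `v` (`ψ_v` class-preserving) the finite-place equations are ★ (ζ2) `localStableOrbitalIntegral_base_eq_of_loc_eq_comp_symm`, so the only
remaining binders are the archimedean equation
`Φ^st_∞(γ₀ ⊗ 1, T_∞; mGi) = Φ^st_∞(γ ⊗ 1, T′_∞; mqi)` (PRINTED at a singular `γ₀`: `G′_∞ ≇ G_∞`) and the two Euler forms.
[cite: Rogawski1990, §14.2 (14.2.1) p. 232; §14.5 p. 238] [cite: Gelbart1975, §10 pp. 154–155] -/
theorem adelicStableOrbitalSum_classesSelf_eq_adelicStableOrbitalIntegralG_of_transport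
    (ψ : ∀ v : HeightOneSpectrum (𝓞 ↥(maximalRealSubfield L)), (UnitaryGroup.cmDatum L 3 H).Local v ≃ₜ* (UnitaryGroup.cmDatum L 3 (Matrix.of fun i j : Fin 3 => if i.val + j.val + 1 = 3 then (1 : L) else 0)).Local v)
    (hcl : ∀ v (γ' : (UnitaryGroup.cmDatum L 3 H).Local v),
      Corresponds (UnitaryGroup.conjLocal L (IsCMField.complexConj L) v) ((UnitaryGroup.adelicForm L 3 H).map (UnitaryGroup.adeleToLocal L v))
        ((UnitaryGroup.adelicForm L 3 (Matrix.of fun i j : Fin 3 => if i.val + j.val + 1 = 3 then (1 : L) else 0)).map (UnitaryGroup.adeleToLocal L v)) γ' (ψ v γ'))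
    (mG : ∀ v : HeightOneSpectrum (𝓞 ↥(maximalRealSubfield L)), OrbitalMeasureFamily ((UnitaryGroup.cmDatum L 3 H).Local v))
    (mGi : OrbitalMeasureFamily (UnitaryGroup.arch (↥(maximalRealSubfield L)) L (IsCMField.complexConj L) 3 H))
    (mqi : OrbitalMeasureFamily (UnitaryGroup.arch (↥(maximalRealSubfield L)) L (IsCMField.complexConj L) 3 (Matrix.of fun i j : Fin 3 => if i.val + j.val + 1 = 3 then (1 : L) else 0)))
    (T : UnitaryGroup.PureTensor L 3 H) (T' : UnitaryGroup.PureTensor L 3 (Matrix.of fun i j : Fin 3 => if i.val + j.val + 1 = 3 then (1 : L) else 0)) (hloc : ∀ v, T'.loc v = T.loc v ∘ (ψ v).symm)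
    (hγ : Corresponds (cmConjRingHom L) H (Matrix.of fun i j : Fin 3 => if i.val + j.val + 1 = 3 then (1 : L) else 0) γ₀ γ)
    (harch : archStableOrbitalIntegral L 3 H mGi T.arch (cmRationalToArch L 3 H γ₀) = archStableOrbitalIntegral L 3 (Matrix.of fun i j : Fin 3 => if i.val + j.val + 1 = 3 then (1 : L) else 0) mqi T'.arch (cmRationalToArch L 3 (Matrix.of fun i j : Fin 3 => if i.val + j.val + 1 = 3 then (1 : L) else 0) γ))
    (mA' : OrbitalMeasureFamily (UnitaryGroup.cmDatum L 3 H).Adelic) (F' : (UnitaryGroup.cmDatum L 3 H).Adelic → ℂ)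
    (mA : OrbitalMeasureFamily (UnitaryGroup.cmDatum L 3 (Matrix.of fun i j : Fin 3 => if i.val + j.val + 1 = 3 then (1 : L) else 0)).Adelic) (F : (UnitaryGroup.cmDatum L 3 (Matrix.of fun i j : Fin 3 => if i.val + j.val + 1 = 3 then (1 : L) else 0)).Adelic → ℂ)
    (hG' : ∃ S₁' : Finset (HeightOneSpectrum (𝓞 ↥(maximalRealSubfield L))), ∀ S, S₁' ⊆ S →
      IsEulerOnClasses (MatchingAdeleG₂.classes L H H γ₀) mA' F' S
        (fun v => localStableOrbitalIntegral L 3 H v (mG v) (T.loc v) ((UnitaryGroup.cmDatum L 3 H).toLocal v ((UnitaryGroup.cmDatum L 3 H).toAdelic γ₀)))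
        (archStableOrbitalIntegral L 3 H mGi T.arch (cmRationalToArch L 3 H γ₀)))
    (hG : ∃ S₁ : Finset (HeightOneSpectrum (𝓞 ↥(maximalRealSubfield L))), ∀ S, S₁ ⊆ S →
      IsEulerOnClasses (MatchingAdeleG.classes L H γ₀) mA F S
        (fun v => localStableOrbitalIntegral L 3 (Matrix.of fun i j : Fin 3 => if i.val + j.val + 1 = 3 then (1 : L) else 0) v ((mG v).transport (ψ v).toMulEquiv (ψ v).continuous (ψ v).symm.continuous) (T'.loc v)
          ((UnitaryGroup.cmDatum L 3 (Matrix.of fun i j : Fin 3 => if i.val + j.val + 1 = 3 then (1 : L) else 0)).toLocal v ((UnitaryGroup.cmDatum L 3 (Matrix.of fun i j : Fin 3 => if i.val + j.val + 1 = 3 then (1 : L) else 0)).toAdelic γ)))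
        (archStableOrbitalIntegral L 3 (Matrix.of fun i j : Fin 3 => if i.val + j.val + 1 = 3 then (1 : L) else 0) mqi T'.arch (cmRationalToArch L 3 (Matrix.of fun i j : Fin 3 => if i.val + j.val + 1 = 3 then (1 : L) else 0) γ))) :
    adelicStableOrbitalSum (MatchingAdeleG₂.classes L H H γ₀) mA' F' = adelicStableOrbitalIntegralG L H γ₀ mA F :=
  adelicStableOrbitalSum_classesSelf_eq_adelicStableOrbitalIntegralG_of_forall_eq mG
    (fun v => (mG v).transport (ψ v).toMulEquiv (ψ v).continuous (ψ v).symm.continuous) mGi mqi T.loc T'.loc T.arch T'.arch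
    (fun v => localStableOrbitalIntegral_base_eq_of_loc_eq_comp_symm v (ψ v) (hcl v) (mG v) (hloc v) hγ) harch mA' F' mA F hG' hG

end Assembly

end Literature.NumberTheory.Rogawski1990

end
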